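import Literature.MathematicalPhysics.QuantumFieldTheory.Balaban1983to89.HaarExponentialChartGlobal
import HarnessLib

/-!
# `Balaban1983to89.LogChartProduct` — the PRODUCT over a finite bond set of a log-charted linear group is log-charted:
# `G^B ⊂ 𝔸^B` with Lie algebra `𝔤^B`, exponential chart `(Θ^B A)(b) = Θ(A(b))`; every theorem of the
# `HaarExponentialChart*` files (Helgason Ch. I Thm 1.14 at measure level) thereby applies to the configuration space
# `G^B` of a lattice gauge field AS ONE COMPACT GROUP — [Balaban1985UV3] (13)→(18) p. 260 «∫ Π_{b∈Ω₁} dU′(b) …» read as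
# the Haar measure of the product group

Companion (outside the `lit-balaban` cell; seat `ym-ir-lit-4`, cell `ym-ir`, 2026-08-28) of gen-8's `LogChart` ∕ `IsChartRep`
(`BlockAveragingFederbushGValued`, `HaarExponentialChart`).  Consumer: `Literature/Analysis/Asymptotics/LaplaceMethodCompactGroup`
(Laplace's method ∕ concentration of Gibbs measures `e^{−βf}dμ∕Z` on a compact group faithfully represented) applied to
`G^B` — semiclassical expectations of a lattice gauge theory on a finite bond set `B` at a unique non-degenerate minimum
(e.g. after a complete axial gauge on a contractible region).

CONTENT (0 sorry, 0 named facts, axioms standard):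
* §1 `mlog_pi_apply` — the series logarithm (21) of `𝔸^B` (sup norm) is componentwise on `‖g − 1‖ < 1`;
  ★ `piLogChart C B : LogChart (B → 𝔸)` — carrier `{g | ∀ b, g b ∈ C.carrier}`, Lie algebra
  `Submodule.pi univ (fun _ => C.lie)`, radius `min(C.ρ, 1/2)` (so that the logarithm is componentwise);
  `mem_piLogChart_carrier`, `mem_piLogChart_lie`, `lie_adStable_pi`, `finiteDimensional_piLogChart_lie`
  (a theorem, not an instance: `haveI` it);
* §2 ★ `isChartRep_pi : IsChartRep C ρ → IsChartRep (piLogChart C B) (MonoidHom.compLeft ρ B)` (the compact group `B → G`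
  with the diagonal representation), ★ `expChart_pi_apply : (Θ^B A) b = Θ (A b)`, `expChart_pi_eq`.
Everything in Helgason's theorem for `G^B` (windows, `jacDensity`, `haar_restrict_window_eq_smul_chartMeasure`,
`setIntegral_haar_image_eq`, …) is then available by instantiation at `isChartRep_pi B h`, for EVERY Haar measure on
`B → G` — in particular `Measure.pi (fun _ => μ)` (Mathlib `Measure.pi.isHaarMeasure`).

HONEST SCOPE: bookkeeping (a product of charts is a chart); no new analysis.  Nothing here is a claim about the Yang–Mills
mass gap (Clay: NOT proved); `R4` closes only `BalabanLadder.UV`.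

## References
* S. Helgason, *Groups and Geometric Analysis*, AMS Math. Surveys Monogr. 83 (2000), Ch. I §1 Thm 1.14, p. 96. [Helgason2000]
* T. Bałaban, *Ultraviolet stability of three-dimensional lattice pure gauge field theories*, Commun. Math. Phys. **102**
  (1985) 255–275, (18) p. 260 (the product over the bond set `Ω₁`). [Balaban1985UV3]
* T. Bałaban, *Averaging operations for lattice gauge theories*, Commun. Math. Phys. **98** (1985) 17–51, (21) p. 21 (the
  logarithmic series). [Balaban1985Averaging]
-/

noncomputable section

open NormedSpace Set Function Filter Topology MeasureTheory
open scoped ENNReal NNReal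

namespace Literature.MathematicalPhysics.QuantumFieldTheory.Balaban1983to89

namespace LogChartProduct

open MatrixLog (mlog hasSum_mlog)
open Literature.Analysis.Complex (logSeriesCoeff)
open HaarExponentialChart

/-! ## §1 The product log-chart -/

section Chart

variable {𝔸 : Type*} [NormedRing 𝔸] [NormedAlgebra ℂ 𝔸] [CompleteSpace 𝔸]
variable (C : LogChart 𝔸) (B : Type*) [Fintype B]

omit [NormedAlgebra ℂ 𝔸] [CompleteSpace 𝔸] in
/-- A component of `g − 1` is bounded by the sup norm. [folklore] -/
private theorem norm_apply_sub_one_le (g : B → 𝔸) (b : B) : ‖g b - 1‖ ≤ ‖g - 1‖ := by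
  have := norm_le_pi_norm (g - 1) b
  simpa only [Pi.sub_apply, Pi.one_apply] using this

/-- **The series logarithm (21) of the sup-normed product algebra `𝔸^B` is componentwise** on `‖g − 1‖ < 1`:
`(log g)(b) = log(g(b))`. [cite: Balaban1985Averaging, (21) p.21] -/
theorem mlog_pi_apply {g : B → 𝔸} (hg : ‖g - 1‖ < 1) (b : B) : mlog g b = mlog (g b) := by
  have h1 := hasSum_mlog hg
  have hb : ‖g b - 1‖ < 1 := lt_of_le_of_lt (norm_apply_sub_one_le B g b) hg
  have h2 := hasSum_mlog hb
  have h3 : HasSum (fun n : ℕ => (logSeriesCoeff n • (g - 1) ^ n) b) (mlog g b) := Pi.hasSum.1 h1 b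
  simp only [Pi.smul_apply, Pi.pow_apply, Pi.sub_apply, Pi.one_apply] at h3
  exact h3.unique h2

/-- ★ **THE PRODUCT LOG-CHART**: for a log-charted linear group `G ⊂ 𝔸` (`C : LogChart 𝔸`) and a finite bond set `B`, the
product `G^B ⊂ 𝔸^B` (sup norm) with Lie algebra `𝔤^B` and log radius `min(ρ, 1/2)` is log-charted: `exp` and the series
`log` of `𝔸^B` act componentwise. [cite: Balaban1985UV3, (18) p. 260 (product over the bond set)]
[cite: Helgason2000, Ch. I §1 Thm 1.14 p. 96] -/
def piLogChart : LogChart (B → 𝔸) where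
  carrier := {g | ∀ b, g b ∈ C.carrier}
  lie := Submodule.pi Set.univ fun _ : B => C.lie
  ρ := min C.ρ (1 / 2)
  ρ_pos := lt_min C.ρ_pos (by norm_num)
  one_mem := fun _ => C.one_mem
  mul_mem := fun _ _ ha hb i => C.mul_mem (ha i) (hb i)
  isClosed := by
    have : {g : B → 𝔸 | ∀ b, g b ∈ C.carrier} = ⋂ b, (fun g : B → 𝔸 => g b) ⁻¹' C.carrier := by
      ext g; simp
    rw [this]
    exact isClosed_iInter fun b => C.isClosed.preimage (continuous_apply b)
  exp_mem := by
    letI : NormedAlgebra ℚ 𝔸 := NormedAlgebra.restrictScalars ℚ ℂ 𝔸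
    intro A hA b
    rw [Pi.coe_exp]
    exact C.exp_mem ((Submodule.mem_pi.1 hA) b (Set.mem_univ b))
  mlog_mem := by
    intro g hg hgn
    have hlt : ‖g - 1‖ < 1 := lt_of_le_of_lt hgn (lt_of_le_of_lt (min_le_right _ _) (by norm_num))
    refine Submodule.mem_pi.2 fun b _ => ?_
    rw [mlog_pi_apply B hlt b]
    exact C.mlog_mem (hg b) ((norm_apply_sub_one_le B g b).trans (hgn.trans (min_le_left _ _)))

/-- Membership in the product carrier is componentwise. [cite: Helgason2000, Ch. I §1 Thm 1.14 p. 96] -/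
@[simp] theorem mem_piLogChart_carrier {g : B → 𝔸} : g ∈ (piLogChart C B).carrier ↔ ∀ b, g b ∈ C.carrier := Iff.rfl

/-- Membership in the product Lie algebra is componentwise. [cite: Helgason2000, Ch. I §1 Thm 1.14 p. 96] -/
@[simp] theorem mem_piLogChart_lie {A : B → 𝔸} : A ∈ (piLogChart C B).lie ↔ ∀ b, A b ∈ C.lie := by
  simp [piLogChart, Submodule.mem_pi]

/-- The log radius of the product chart: `min(ρ, 1/2)`. [cite: Helgason2000, Ch. I §1 Thm 1.14 p. 96] -/
theorem piLogChart_rho : (piLogChart C B).ρ = min C.ρ (1 / 2) := rfl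

/-- `𝔤^B` is `ad`-stable when `𝔤` is (hypothesis `hlie` of the Haar-chart files). [cite: Helgason2000, Ch. I §1 Thm 1.14 (12) p. 96] -/
theorem lie_adStable_pi (hlie : ∀ x ∈ C.lie, ∀ y ∈ C.lie, x * y - y * x ∈ C.lie) :
    ∀ x ∈ (piLogChart C B).lie, ∀ y ∈ (piLogChart C B).lie, x * y - y * x ∈ (piLogChart C B).lie := by
  intro x hx y hy
  rw [mem_piLogChart_lie] at hx hy ⊢
  intro b
  simpa only [Pi.sub_apply, Pi.mul_apply] using hlie _ (hx b) _ (hy b)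

/-- A component of an element of `𝔤^B`, as an element of `𝔤`. [cite: Helgason2000, Ch. I §1 Thm 1.14 p. 96] -/
def lieApply (A : (piLogChart C B).lie) (b : B) : C.lie :=
  ⟨(A : B → 𝔸) b, (mem_piLogChart_lie C B).1 A.2 b⟩

/-- Unfolding lemma. [cite: Helgason2000, Ch. I §1 Thm 1.14 p. 96] -/
@[simp] theorem coe_lieApply (A : (piLogChart C B).lie) (b : B) : (lieApply C B A b : 𝔸) = (A : B → 𝔸) b := rfl

/-- `𝔤^B ≃ₗ (B → 𝔤)` (componentwise). [cite: Helgason2000, Ch. I §1 Thm 1.14 p. 96] -/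
def lieEquivPi : (piLogChart C B).lie ≃ₗ[ℝ] (B → C.lie) where
  toFun A b := lieApply C B A b
  invFun Y := ⟨fun b => (Y b : 𝔸), (mem_piLogChart_lie C B).2 fun b => (Y b).2⟩
  map_add' _ _ := by ext; rfl
  map_smul' _ _ := by ext; rfl
  left_inv _ := by ext; rfl
  right_inv _ := by ext; rfl

/-- `𝔤^B` is finite-dimensional when `𝔤` is (a theorem; use `haveI`). [cite: Helgason2000, Ch. I §1 Thm 1.14 p. 96] -/
theorem finiteDimensional_piLogChart_lie [FiniteDimensional ℝ C.lie] : FiniteDimensional ℝ (piLogChart C B).lie :=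
  LinearEquiv.finiteDimensional (lieEquivPi C B).symm

end Chart

/-! ## §2 The product of a faithfully represented compact group is faithfully represented; its exponential chart -/

section Rep

variable {𝔸 : Type*} [NormedRing 𝔸] [NormedAlgebra ℂ 𝔸] [CompleteSpace 𝔸]
variable {G : Type*} [Group G] [TopologicalSpace G]
variable {C : LogChart 𝔸} {ρ : G →* 𝔸} (B : Type*) [Fintype B]

/-- ★ **`G^B` IS FAITHFULLY REPRESENTED ON THE PRODUCT CHART**: if `ρ : G →* 𝔸` is a chart representation onto `C`, the
diagonal `ρ^B : (B → G) →* (B → 𝔸)` (Mathlib `MonoidHom.compLeft ρ B`) is one onto `piLogChart C B`.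
[cite: Helgason2000, Ch. I §1 Thm 1.14 p. 96] [cite: Balaban1985UV3, (18) p. 260] -/
theorem isChartRep_pi (h : IsChartRep C ρ) : IsChartRep (piLogChart C B) (MonoidHom.compLeft ρ B) where
  continuous := continuous_pi fun b => h.continuous.comp (continuous_apply b)
  injective := fun x y hxy => funext fun b => h.injective (congrFun hxy b)
  range_eq := by
    ext g
    simp only [Set.mem_range, mem_piLogChart_carrier]
    constructor
    · rintro ⟨x, rfl⟩ b
      have : ρ (x b) ∈ Set.range ρ := ⟨x b, rfl⟩
      rw [h.range_eq] at this
      exact this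
    · intro hg
      have hg' : ∀ b, g b ∈ Set.range ρ := fun b => by rw [h.range_eq]; exact hg b
      choose x hx using hg'
      exact ⟨x, funext hx⟩

/-- ★ **The exponential chart of `G^B` is componentwise**: `(Θ^B A)(b) = Θ(A(b))`.
[cite: Helgason2000, Ch. I §1 Thm 1.14 p. 96] -/
theorem expChart_pi_apply (h : IsChartRep C ρ) (A : (piLogChart C B).lie) (b : B) :
    (isChartRep_pi B h).expChart A b = h.expChart (lieApply C B A b) := by
  letI : NormedAlgebra ℚ 𝔸 := NormedAlgebra.restrictScalars ℚ ℂ 𝔸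
  apply h.injective
  have h1 := congrFun ((isChartRep_pi B h).rho_expChart A) b
  simp only [MonoidHom.compLeft_apply, Function.comp_apply] at h1
  rw [h1, h.rho_expChart, coe_lieApply, Pi.coe_exp]

/-- The same as an identity of functions. [cite: Helgason2000, Ch. I §1 Thm 1.14 p. 96] -/
theorem expChart_pi_eq (h : IsChartRep C ρ) (A : (piLogChart C B).lie) :
    (isChartRep_pi B h).expChart A = fun b => h.expChart (lieApply C B A b) :=
  funext fun b => expChart_pi_apply B h A b

/-- `Θ^B 0 = 1` componentwise (sanity). [cite: Helgason2000, Ch. I §1 Thm 1.14 p. 96] -/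
theorem expChart_pi_zero (h : IsChartRep C ρ) : (isChartRep_pi B h).expChart 0 = 1 :=
  (isChartRep_pi B h).expChart_zero

end Rep

end LogChartProduct

end Literature.MathematicalPhysics.QuantumFieldTheory.Balaban1983to89
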